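import Mathlib
import HarnessLib
import Summits.ValiantsHypothesis.ValiantsHypothesis.Theorems.MonotoneRestorationOrbitRestorationQPNormalisedFactors

/-!
# Eigen-free factor families can be rescaled to be exactly permuted (SPAN currency; units → exact permutation, II)

Route MonotoneRestoration, crux `OrbitRestorationQP` (stmt-ValiantsHypothesis-18293), SPAN-currency lane of the open
sub-rung A_∞ (`stub_sigmaPiSigmaValue`), `ΠΣ` part.  Helper (`--supports`), def-free.  Sequel to
`…NormalisedFactors.lean` (invariant normalisers).

A factor `L_i` of an affine product is an EIGEN-FACTOR if some row/column renaming rescales it non-trivially: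
`(σ,τ) · L_i = c · L_i` with `c ≠ 1` (e.g. `x_{aq} − x_{a'q}` under the row transposition `(a a')`, `c = −1`; or
`x_{aq} + ω x_{a'q} + ω² x_{a''q}` under a `3`-cycle, `c = ω²`).  The family is EIGEN-FREE if it has no eigen-factor.

* `translate_scalar_unique` — in an eigen-free family, two translates of one factor lying on the line of another
  factor coincide (`(σ,τ) · L_j = c · L_i`, `(σ',τ') · L_j = c' · L_i` ⇒ `c = c'`);
* **`exists_rescaling_exactly_permuted_of_eigenFree`** — UNITS → EXACT PERMUTATION: if `C a · Π_i L_i ≠ 0` (degree-one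
  factors) is invariant under all row/column renamings and the family is eigen-free, then after rescaling each factor by
  a nonzero constant the family is permuted EXACTLY by every renaming.  Construction: rescale `L_i` to the (unique, by
  `translate_scalar_unique`) translate on its line of a canonically chosen factor of its line-orbit; the scalar of a
  rescaled factor is then an invariant normaliser and `NormalisedFactors.exists_perm_rename_eq_of_normaliser` applies;
* **`prod_mem_narrowSpan_of_eigenFree_matrixSymmetric`** — COROLLARY: an eigen-free matrix-symmetric affine product
  (`|ι| < C(n,k)`, `8 < n`, `1 ≤ k`, `4k ≤ n`, nonzero) lies in `span_ℂ {hom_{F,n} : tw F ≤ 2k − 1}` (polynomial orbits), by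
  the untwisted `ΠΣ` theorem `CorePatterns.prod_mem_narrowSpan_of_untwisted_matrixSymmetric`.

So the twisted residue of the `ΠΣ` sub-rung in span currency consists of the families with a genuine eigen-factor.
(Eigen-freeness is sufficient, not necessary: even multiplicities absorb sign twists, e.g. `{ℓ, −ℓ}` is exactly
permuted by a renaming negating `ℓ`.)  "No balanced factor" (`…NormalisedFactors.lean`) is the special case where the
constant term or the coefficient sum certifies eigen-freeness.

Honest label: bookkeeping for the span-currency lane of A_∞'s `ΠΣ` sub-rung; no registered stub is closed; the crux and
VP ≠ VNP are not moved. [folklore]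
-/

noncomputable section

-- `Summit.ValiantsHypothesis.ValiantsHypothesis.…` is the tree's single-conjunct layout (Sub = Summit).
set_option linter.dupNamespace false

namespace Summit.ValiantsHypothesis.ValiantsHypothesis.Theorems

namespace NormalisedFactors

open MvPolynomial Finset Equiv ProductAction
open Literature.Computability.AlgebraicComplexity (homPoly)
open Literature.Combinatorics.SimpleGraph (treewidth)

variable {n : ℕ}

/-! ### The row/column renamings form a group action -/

/-- Composition of two row/column renamings. [folklore] -/
theorem rename_rowCol_mul (σ τ σ' τ' : Perm (Fin n)) (p : MvPolynomial (Fin n × Fin n) ℂ) :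
    rename (fun P : Fin n × Fin n => (σ P.1, τ P.2)) (rename (fun P : Fin n × Fin n => (σ' P.1, τ' P.2)) p) =
      rename (fun P : Fin n × Fin n => ((σ * σ') P.1, (τ * τ') P.2)) p := by
  rw [rename_rename]
  rfl

/-- The trivial row/column renaming is the identity. [folklore] -/
theorem rename_rowCol_one (p : MvPolynomial (Fin n × Fin n) ℂ) :
    rename (fun P : Fin n × Fin n => ((1 : Perm (Fin n)) P.1, (1 : Perm (Fin n)) P.2)) p = p := by
  have h : (fun P : Fin n × Fin n => ((1 : Perm (Fin n)) P.1, (1 : Perm (Fin n)) P.2)) = id := by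
    funext P
    rfl
  rw [h, rename_id]
  rfl

/-- A row/column renaming is undone by the inverse renaming. [folklore] -/
theorem rename_rowCol_inv (σ τ : Perm (Fin n)) (p : MvPolynomial (Fin n × Fin n) ℂ) :
    rename (fun P : Fin n × Fin n => (σ⁻¹ P.1, τ⁻¹ P.2)) (rename (fun P : Fin n × Fin n => (σ P.1, τ P.2)) p) = p := by
  rw [rename_rowCol_mul, inv_mul_cancel, inv_mul_cancel, rename_rowCol_one]

/-! ### Eigen-free families: translates on a line are unique -/

/-- **In an eigen-free family, two translates of one factor on the line of another factor coincide.** [folklore] -/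
theorem translate_scalar_unique {ι : Type} (L : ι → MvPolynomial (Fin n × Fin n) ℂ) (hL0 : ∀ i, L i ≠ 0)
    (heigen : ∀ (σ τ : Perm (Fin n)) (i : ι) (c : ℂ),
      rename (fun P : Fin n × Fin n => (σ P.1, τ P.2)) (L i) = C c * L i → c = 1)
    {σ τ σ' τ' : Perm (Fin n)} {j i : ι} {c c' : ℂ}
    (h : rename (fun P : Fin n × Fin n => (σ P.1, τ P.2)) (L j) = C c * L i)
    (h' : rename (fun P : Fin n × Fin n => (σ' P.1, τ' P.2)) (L j) = C c' * L i) : c = c' := by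
  have hj : L j = C c * rename (fun P : Fin n × Fin n => (σ⁻¹ P.1, τ⁻¹ P.2)) (L i) := by
    have h2 := congrArg (rename (fun P : Fin n × Fin n => (σ⁻¹ P.1, τ⁻¹ P.2))) h
    rwa [rename_rowCol_inv, map_mul, rename_C] at h2
  have hc : c ≠ 0 := by
    rintro rfl
    rw [C_0, zero_mul] at hj
    exact hL0 j hj
  have h2 : C c * rename (fun P : Fin n × Fin n => ((σ' * σ⁻¹) P.1, (τ' * τ⁻¹) P.2)) (L i) = C c' * L i := by
    rw [← rename_rowCol_mul, ← rename_C (fun P : Fin n × Fin n => (σ' P.1, τ' P.2)) c, ← map_mul, ← hj]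
    exact h'
  have h3 : rename (fun P : Fin n × Fin n => ((σ' * σ⁻¹) P.1, (τ' * τ⁻¹) P.2)) (L i) = C (c⁻¹ * c') * L i := by
    have h4 := congrArg (fun q => C c⁻¹ * q) h2
    rwa [← mul_assoc, ← mul_assoc, ← map_mul, ← map_mul, inv_mul_cancel₀ hc, C_1, one_mul] at h4
  have h5 := heigen _ _ i _ h3
  calc c = c * (c⁻¹ * c') := by rw [h5, mul_one]
    _ = c' := by rw [← mul_assoc, mul_inv_cancel₀ hc, one_mul]

/-! ### The rescaling -/

/-- **UNITS → EXACT PERMUTATION (eigen-free families).**  Let `C a · Π_i L_i ≠ 0` (degree-one factors) be invariant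
under every row/column renaming, and suppose the family is EIGEN-FREE: `(σ,τ) · L_i = c · L_i ⇒ c = 1`.  Then there are
nonzero constants `d_i` such that every renaming permutes the rescaled family `(d_i · L_i)_i` EXACTLY. [folklore] -/
theorem exists_rescaling_exactly_permuted_of_eigenFree {ι : Type} [Fintype ι]
    (L : ι → MvPolynomial (Fin n × Fin n) ℂ) (a : ℂ) (hL1 : ∀ i, (L i).totalDegree = 1) (hf0 : C a * ∏ i, L i ≠ 0)
    (hfix : ∀ σ τ : Perm (Fin n),
      rename (fun P : Fin n × Fin n => (σ P.1, τ P.2)) (C a * ∏ i, L i) = C a * ∏ i, L i)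
    (heigen : ∀ (σ τ : Perm (Fin n)) (i : ι) (c : ℂ),
      rename (fun P : Fin n × Fin n => (σ P.1, τ P.2)) (L i) = C c * L i → c = 1) :
    ∃ d : ι → ℂ, (∀ i, d i ≠ 0) ∧ ∀ σ τ : Perm (Fin n), ∃ κ : Perm ι, ∀ i,
      rename (fun P : Fin n × Fin n => (σ P.1, τ P.2)) (C (d i) * L i) = C (d (κ i)) * L (κ i) := by
  classical
  have hL0 : ∀ i, L i ≠ 0 := by
    intro i h
    exact hf0 (by rw [Finset.prod_eq_zero (Finset.mem_univ i) h, mul_zero])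
  -- unique factorisation: every renaming maps a factor onto the line of a factor
  have hassoc : ∀ (σ τ : Perm (Fin n)) (i : ι), ∃ (i' : ι) (c : ℂ), c ≠ 0 ∧
      rename (fun P : Fin n × Fin n => (σ P.1, τ P.2)) (L i) = C c * L i' := by
    intro σ τ i
    have hrel := rel_associated_of_rename_prod_eq L a hL1 hf0 σ τ (hfix σ τ)
    have hmem : rename (fun P : Fin n × Fin n => (σ P.1, τ P.2)) (L i) ∈
        ((univ : Finset ι).val.map L).map (rename (fun P : Fin n × Fin n => (σ P.1, τ P.2))) :=
      Multiset.mem_map_of_mem _ (Multiset.mem_map_of_mem _ (Finset.mem_univ_val i))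
    obtain ⟨y, hy, hxy⟩ := Multiset.exists_mem_of_rel_of_mem hrel hmem
    obtain ⟨i', -, rfl⟩ := Multiset.mem_map.1 hy
    obtain ⟨c, hc0, hc⟩ := SupportBlocks.exists_C_of_associated hxy.symm
    exact ⟨i', c, hc0, hc⟩
  -- the line-orbit relation `Q i j`: some translate of `L j` lies on the line of `L i`
  set Q : ι → ι → Prop := fun i j => ∃ (σ τ : Perm (Fin n)) (c : ℂ), c ≠ 0 ∧
    rename (fun P : Fin n × Fin n => (σ P.1, τ P.2)) (L j) = C c * L i with hQ
  have hQrefl : ∀ i, Q i i := fun i => ⟨1, 1, 1, one_ne_zero, by rw [rename_rowCol_one, C_1, one_mul]⟩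
  have hQtrans : ∀ (i i' : ι) (σ τ : Perm (Fin n)) (c : ℂ), c ≠ 0 →
      rename (fun P : Fin n × Fin n => (σ P.1, τ P.2)) (L i) = C c * L i' → Q i = Q i' := by
    intro i i' σ τ c hc h
    funext j
    apply propext
    constructor
    · rintro ⟨σ₁, τ₁, c₁, hc₁, h₁⟩
      refine ⟨σ * σ₁, τ * τ₁, c₁ * c, mul_ne_zero hc₁ hc, ?_⟩
      rw [← rename_rowCol_mul, h₁, map_mul, rename_C, h, ← mul_assoc, ← map_mul]
    · rintro ⟨σ₁, τ₁, c₁, hc₁, h₁⟩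
      refine ⟨σ⁻¹ * σ₁, τ⁻¹ * τ₁, c₁ * c⁻¹, mul_ne_zero hc₁ (inv_ne_zero hc), ?_⟩
      have hi : rename (fun P : Fin n × Fin n => (σ⁻¹ P.1, τ⁻¹ P.2)) (L i') = C c⁻¹ * L i := by
        have h2 := congrArg (rename (fun P : Fin n × Fin n => (σ⁻¹ P.1, τ⁻¹ P.2))) h
        rw [rename_rowCol_inv, map_mul, rename_C] at h2
        have h3 := congrArg (fun q => C c⁻¹ * q) h2
        rw [← mul_assoc, ← map_mul, inv_mul_cancel₀ hc, C_1, one_mul] at h3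
        exact h3.symm
      rw [← rename_rowCol_mul, h₁, map_mul, rename_C, hi, ← mul_assoc, ← map_mul]
  -- canonical factor of a line-orbit
  have hne : ∀ i, ∃ j, Q i j := fun i => ⟨i, hQrefl i⟩
  have hchoose : ∀ (P P' : ι → Prop) (hP : ∃ j, P j) (hP' : ∃ j, P' j), P = P' →
      Classical.choose hP = Classical.choose hP' := by
    rintro P P' hP hP' rfl
    rfl
  set jstar : ι → ι := fun i => Classical.choose (hne i) with hjstar
  have hjQ : ∀ i, Q i (jstar i) := fun i => Classical.choose_spec (hne i)
  have hjeq : ∀ i i', Q i = Q i' → jstar i = jstar i' := fun i i' h => hchoose (Q i) (Q i') (hne i) (hne i') h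
  -- the rescaling: `d i · L i` is THE translate of `L (jstar i)` on the line of `L i`
  have hdata : ∀ i, ∃ c : ℂ, c ≠ 0 ∧ ∃ σ τ : Perm (Fin n),
      rename (fun P : Fin n × Fin n => (σ P.1, τ P.2)) (L (jstar i)) = C c * L i := by
    intro i
    obtain ⟨σ, τ, c, hc, h⟩ := hjQ i
    exact ⟨c, hc, σ, τ, h⟩
  choose d hd0 hdst using hdata
  refine ⟨d, hd0, ?_⟩
  -- KEY: every renaming maps a rescaled factor EXACTLY to a rescaled factor
  have hkey : ∀ (σ τ : Perm (Fin n)) (i : ι), ∃ i',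
      rename (fun P : Fin n × Fin n => (σ P.1, τ P.2)) (C (d i) * L i) = C (d i') * L i' := by
    intro σ τ i
    obtain ⟨i', c₁, hc₁, h1⟩ := hassoc σ τ i
    have hj : jstar i = jstar i' := hjeq i i' (hQtrans i i' σ τ c₁ hc₁ h1)
    obtain ⟨σ₁, τ₁, hg⟩ := hdst i
    obtain ⟨σ₂, τ₂, hg'⟩ := hdst i'
    rw [← hj] at hg'
    have ht1 : rename (fun P : Fin n × Fin n => ((σ * σ₁) P.1, (τ * τ₁) P.2)) (L (jstar i)) = C (d i * c₁) * L i' := by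
      rw [← rename_rowCol_mul, hg, map_mul, rename_C, h1, ← mul_assoc, ← map_mul]
    have heq := translate_scalar_unique L hL0 heigen ht1 hg'
    refine ⟨i', ?_⟩
    rw [map_mul, rename_C, h1, ← mul_assoc, ← map_mul, heq]
  -- COHERENCE: rescaled factors on a common line are equal
  have hcoh : ∀ (i i₂ : ι) (c c' : ℂ), c ≠ 0 → c' ≠ 0 →
      C c * (C (d i) * L i) = C c' * (C (d i₂) * L i₂) → c = c' := by
    intro i i₂ c c' hc hc' h
    rw [← mul_assoc, ← mul_assoc, ← map_mul, ← map_mul] at h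
    -- `L i = u · L i₂`
    set u : ℂ := (c * d i)⁻¹ * (c' * d i₂) with hu
    have hcd : c * d i ≠ 0 := mul_ne_zero hc (hd0 i)
    have hLi : L i = C u * L i₂ := by
      have h2 := congrArg (fun q => C (c * d i)⁻¹ * q) h
      rwa [← mul_assoc, ← mul_assoc, ← map_mul, ← map_mul, inv_mul_cancel₀ hcd, C_1, one_mul] at h2
    have hu0 : u ≠ 0 := mul_ne_zero (inv_ne_zero hcd) (mul_ne_zero hc' (hd0 i₂))
    have h1 : rename (fun P : Fin n × Fin n => ((1 : Perm (Fin n)) P.1, (1 : Perm (Fin n)) P.2)) (L i) =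
        C u * L i₂ := by rw [rename_rowCol_one, hLi]
    have hj : jstar i = jstar i₂ := hjeq i i₂ (hQtrans i i₂ 1 1 u hu0 h1)
    obtain ⟨σ₁, τ₁, hg⟩ := hdst i
    obtain ⟨σ₂, τ₂, hg'⟩ := hdst i₂
    rw [← hj] at hg'
    rw [hLi, ← mul_assoc, ← map_mul] at hg
    -- two translates of `L (jstar i)` on the line of `L i₂`
    have heq := translate_scalar_unique L hL0 heigen hg hg'
    -- conclude
    rw [hLi, ← mul_assoc, ← map_mul] at h
    have h3 := mul_right_cancel₀ (hL0 i₂) h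
    have h4 : c * d i * u = c' * d i₂ := (C_injective _ _) h3
    rw [mul_assoc, heq] at h4
    exact mul_right_cancel₀ (hd0 i₂) h4
  -- the normaliser: the scalar of a multiple of a rescaled factor
  set N : MvPolynomial (Fin n × Fin n) ℂ → ℂ := fun p =>
    if h : ∃ i, ∃ c : ℂ, c ≠ 0 ∧ p = C c * (C (d i) * L i) then h.choose_spec.choose else 0 with hN
  have hNspec : ∀ (i : ι) (c : ℂ), c ≠ 0 → N (C c * (C (d i) * L i)) = c := by
    intro i c hc
    have h : ∃ i', ∃ c' : ℂ, c' ≠ 0 ∧ C c * (C (d i) * L i) = C c' * (C (d i') * L i') := ⟨i, c, hc, rfl⟩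
    have hval : N (C c * (C (d i) * L i)) = h.choose_spec.choose := by
      simp only [hN]
      rw [dif_pos h]
    rw [hval]
    obtain ⟨hc', heq⟩ := h.choose_spec.choose_spec
    exact (hcoh _ _ _ _ hc hc' heq).symm
  have hNzero : N 0 = 0 := by
    have h : ¬ ∃ i, ∃ c : ℂ, c ≠ 0 ∧ (0 : MvPolynomial (Fin n × Fin n) ℂ) = C c * (C (d i) * L i) := by
      rintro ⟨i, c, hc, h⟩
      have : C c * (C (d i) * L i) ≠ 0 :=
        mul_ne_zero (fun h' => hc ((C_eq_zero).1 h')) (mul_ne_zero (fun h' => hd0 i ((C_eq_zero).1 h')) (hL0 i))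
      exact this h.symm
    simp only [hN]
    rw [dif_neg h]
  -- the rescaled product
  set L' : ι → MvPolynomial (Fin n × Fin n) ℂ := fun i => C (d i) * L i with hL'
  set D : ℂ := ∏ i, d i with hD
  have hD0 : D ≠ 0 := Finset.prod_ne_zero_iff.2 fun i _ => hd0 i
  have hprodL' : (∏ i, L' i) = C D * ∏ i, L i := by
    rw [hL', Finset.prod_mul_distrib, ← map_prod]
  have hf : C a * ∏ i, L i = C (a * D⁻¹) * ∏ i, L' i := by
    rw [hprodL', ← mul_assoc, ← map_mul, mul_assoc, inv_mul_cancel₀ hD0, mul_one]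
  have hL'1 : ∀ i, (L' i).totalDegree = 1 := by
    intro i
    rw [hL', totalDegree_C_mul_of_ne_zero (hd0 i) (hL0 i), hL1 i]
  have hf0' : C (a * D⁻¹) * ∏ i, L' i ≠ 0 := by rwa [← hf]
  intro σ τ
  have hfix' : rename (fun P : Fin n × Fin n => (σ P.1, τ P.2)) (C (a * D⁻¹) * ∏ i, L' i) =
      C (a * D⁻¹) * ∏ i, L' i := by rw [← hf]; exact hfix σ τ
  refine exists_perm_rename_eq_of_normaliser L' (a * D⁻¹) hL'1 hf0' σ τ hfix' N ?_ ?_ ?_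
  · intro i
    obtain ⟨i', hi'⟩ := hkey σ τ i
    simp only [hL']
    rw [hi', ← one_mul (C (d i') * L i'), ← C_1, hNspec i' 1 one_ne_zero, ← one_mul (C (d i) * L i), ← C_1,
      hNspec i 1 one_ne_zero]
  · intro u i
    simp only [hL']
    by_cases hu : u = 0
    · rw [hu, C_0, zero_mul, zero_mul, hNzero]
    · rw [hNspec i u hu, ← one_mul (C (d i) * L i), ← C_1, hNspec i 1 one_ne_zero, mul_one]
  · intro i
    simp only [hL']
    rw [← one_mul (C (d i) * L i), ← C_1, hNspec i 1 one_ne_zero]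

/-! ### Corollary: eigen-free ⇒ constant treewidth -/

/-- **EIGEN-FREE ⇒ POLYNOMIAL ORBITS (span currency).**  Let `f = C a · Π_i L_i ≠ 0` (`|ι| < C(n,k)` affine factors,
`8 < n`, `1 ≤ k`, `4k ≤ n`) be invariant under all row and all column permutations, and suppose no degree-one factor
is an eigen-factor: `(σ,τ) · L_i = c · L_i ⇒ c = 1`.  Then `f ∈ span_ℂ {hom_{F,n} : tw F ≤ 2k − 1}`.
[folklore; cite: DwivediPagoSeppelt2026, §8; DixonMortimer1996, Thm 5.2B] -/
theorem prod_mem_narrowSpan_of_eigenFree_matrixSymmetric {k : ℕ} (hn : 8 < n) (hk : 1 ≤ k) (h4k : 4 * k ≤ n)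
    {ι : Type} [Fintype ι] (L : ι → MvPolynomial (Fin n × Fin n) ℂ) (a : ℂ)
    (hL : ∀ i, (L i).totalDegree ≤ 1) (hcard : Fintype.card ι < n.choose k) (hf0 : C a * ∏ i, L i ≠ 0)
    (hrow : ∀ σ : Perm (Fin n), vact (K := ℂ) rowHom σ (C a * ∏ i, L i) = C a * ∏ i, L i)
    (hcol : ∀ τ : Perm (Fin n), vact (K := ℂ) colHom τ (C a * ∏ i, L i) = C a * ∏ i, L i)
    (heigen : ∀ (σ τ : Perm (Fin n)) (i : ι) (c : ℂ), (L i).totalDegree = 1 →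
      rename (fun P : Fin n × Fin n => (σ P.1, τ P.2)) (L i) = C c * L i → c = 1) :
    (C a * ∏ i, L i) ∈ Submodule.span ℂ {p : MvPolynomial (Fin n × Fin n) ℂ |
        ∃ (a b : ℕ) (E : Multiset (Fin a × Fin b)),
          treewidth (SimpleGraph.fromRel fun u v : Fin a ⊕ Fin b =>
            ∃ e ∈ E, u = Sum.inl e.1 ∧ v = Sum.inr e.2) ≤ 2 * k - 1 ∧ p = homPoly E n ℂ} := by
  classical
  have hLi0 : ∀ i, L i ≠ 0 := by
    intro i h
    exact hf0 (by rw [Finset.prod_eq_zero (Finset.mem_univ i) h, mul_zero])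
  -- split off the constant factors
  set P : ι → Prop := fun i => (L i).totalDegree = 1 with hP
  have hconst : ∀ i, ¬ P i → L i = C (constantCoeff (L i)) := by
    intro i hi
    have h0 : (L i).totalDegree = 0 := by have := hL i; simp only [hP] at hi; omega
    rw [constantCoeff_eq]
    exact (totalDegree_eq_zero_iff_eq_C (p := L i)).1 h0
  set ι₁ := {i // P i} with hι₁
  set L₁ : ι₁ → MvPolynomial (Fin n × Fin n) ℂ := fun i => L i with hL₁
  set b : ℂ := ∏ i : {i // ¬ P i}, constantCoeff (L i) with hb
  have hsplit : C a * ∏ i, L i = C (a * b) * ∏ i : ι₁, L₁ i := by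
    rw [← Fintype.prod_subtype_mul_prod_subtype P L, hb, map_mul, map_prod]
    have hc : (∏ i : {i // ¬ P i}, L (i : ι)) = ∏ i : {i // ¬ P i}, C (constantCoeff (L (i : ι))) :=
      Finset.prod_congr rfl fun i _ => hconst i i.2
    rw [hc]
    ring
  have hL₁1 : ∀ i : ι₁, (L₁ i).totalDegree = 1 := fun i => i.2
  have hf0₁ : C (a * b) * ∏ i : ι₁, L₁ i ≠ 0 := by rwa [← hsplit]
  have hfix₁ : ∀ σ τ : Perm (Fin n),
      rename (fun P : Fin n × Fin n => (σ P.1, τ P.2)) (C (a * b) * ∏ i : ι₁, L₁ i) = C (a * b) * ∏ i : ι₁, L₁ i := by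
    intro σ τ
    rw [← hsplit, rename_prod_eq, hcol τ, hrow σ]
  have heigen₁ : ∀ (σ τ : Perm (Fin n)) (i : ι₁) (c : ℂ),
      rename (fun P : Fin n × Fin n => (σ P.1, τ P.2)) (L₁ i) = C c * L₁ i → c = 1 :=
    fun σ τ i c h => heigen σ τ i c i.2 h
  obtain ⟨d, hd0, hperm⟩ := exists_rescaling_exactly_permuted_of_eigenFree L₁ (a * b) hL₁1 hf0₁ hfix₁ heigen₁
  -- the rescaled degree-one family
  set L' : ι₁ → MvPolynomial (Fin n × Fin n) ℂ := fun i => C (d i) * L₁ i with hL'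
  set D : ℂ := ∏ i, d i with hD
  have hD0 : D ≠ 0 := Finset.prod_ne_zero_iff.2 fun i _ => hd0 i
  have hprodL' : (∏ i, L' i) = C D * ∏ i, L₁ i := by
    rw [hL', Finset.prod_mul_distrib, ← map_prod]
  have hf : C a * ∏ i, L i = C (a * b * D⁻¹) * ∏ i, L' i := by
    rw [hsplit, hprodL', ← mul_assoc, ← map_mul, mul_assoc, inv_mul_cancel₀ hD0, mul_one]
  have hL'1 : ∀ i, (L' i).totalDegree ≤ 1 := by
    intro i
    rw [hL', totalDegree_C_mul_of_ne_zero (hd0 i) (hLi0 i)]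
    exact (hL₁1 i).le
  have hcard' : Fintype.card ι₁ < n.choose k := (Fintype.card_subtype_le P).trans_lt hcard
  have hf0' : C (a * b * D⁻¹) * ∏ i, L' i ≠ 0 := by rwa [← hf]
  have hrow' : ∀ σ : Perm (Fin n), vact (K := ℂ) rowHom σ (C (a * b * D⁻¹) * ∏ i, L' i) =
      C (a * b * D⁻¹) * ∏ i, L' i := by intro σ; rw [← hf]; exact hrow σ
  have hcol' : ∀ τ : Perm (Fin n), vact (K := ℂ) colHom τ (C (a * b * D⁻¹) * ∏ i, L' i) =
      C (a * b * D⁻¹) * ∏ i, L' i := by intro τ; rw [← hf]; exact hcol τ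
  have huntwisted : ∀ σ τ : Perm (Fin n), ∃ κ : Perm ι₁, ∀ i,
      rename (fun P : Fin n × Fin n => (σ P.1, τ P.2)) (L' i) = L' (κ i) := by
    intro σ τ
    obtain ⟨κ, hκ⟩ := hperm σ τ
    exact ⟨κ, fun i => by simp only [hL']; exact hκ i⟩
  rw [hf]
  exact CorePatterns.prod_mem_narrowSpan_of_untwisted_matrixSymmetric hn hk h4k L' (a * b * D⁻¹)
    hL'1 hcard' hf0' hrow' hcol' huntwisted

end NormalisedFactors

end Summit.ValiantsHypothesis.ValiantsHypothesis.Theorems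

end
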